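import Literature.AnabelianGeometry.EtaleTheta.Discharge.Sec3Cor38PerfectionR
import Literature.AnabelianGeometry.EtaleTheta.Discharge.Sec3Cor38StdIsoNotGL
import Literature.AnabelianGeometry.EtaleTheta.Discharge.Sec3Cor38iii
import Literature.AlgebraicGeometry.Frobenioids.Thm42OfPreStepsGeneral
import Literature.AlgebraicGeometry.Frobenioids.PrimesEquivalence
import HarnessLib

/-!
# [EtTh] Corollary 3.8 (iii), first clause — the [FrdI] Thm. 4.2 (i) and Thm. 3.4 (iii) inputs DISCHARGED from
# C38-L02a (pre-step preservation) over print's FSMFF-type bases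

Mochizuki, *The étale theta function …*, Publ. RIMS **45** (2009), Cor. 3.8 (iii), PDF p.81, proof p.82
[cite: MochizukiEtTh2009, Cor 3.8 p.81]: "by Theorem 3.7, (i), (ii), `C₁`, `C₂` are of standard and isotropic type,
but not of group-like type. In particular, by [Mzk17], Theorem 3.4, (ii); [Mzk17], Theorem 4.2, (i), it follows that
`Ψ` preserves pre-steps and primary steps."  [Mzk17] = Mochizuki, *The geometry of Frobenioids I*, Kyushu J. Math.
**62** (2008), Thm. 3.4 (ii)(iii) pp.62–63, Thm. 4.2 (i) p.77 [cite: MochizukiFrdI2008, Thm. 4.2 (i) p.77].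

abc-iut cell, layer L2, node `EtTh:Cor3.8(iii)`, seat abc-iut-w5-d124 (gen 3); proof-only sequel of abc-iut-L2-d2's
`Sec3Cor38iii.lean` (`cor38_iii_of`: the clause modulo "`Ψ`, `Ψ⁻¹` preserve pre-steps / primary pre-steps /
morphisms of Frobenius type" and the Def. 3.1 support axioms) and `Sec3Cor38iiiFSM.lean` (`cor38_iii_of_isOfFSMType`:
pre-steps and Frobenius type discharged over bases of FSM-type, primary pre-steps `hprim`/`hprim'` still binders).
[FrdI] Thm. 4.2 (i) holds for Frobenioids of standard, isotropic, non-group-like type with perf-factorial divisor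
monoids MODULO ONLY pre-step preservation (`FrdI.T42.thm42i_ofFunctor_of_preservesPreSteps`, seat abc-iut-w4-d105),
and so does "`Ψ` is compatible with arrows of Frobenius type" (`Cor38Hyp.isFrobeniusCompatible_of_preservesPreSteps`,
`Sec3Cor38PerfectionR.lean`).  Hence ALL THREE transport inputs of `cor38_iii_of` reduce to the single row C38-L02a
`h.PreservesPreSteps` ([FrdI] Thm. 3.4 (ii); FACT-LIST F-2809 — itself PROVED over print's FSMFF-type bases:
`Cor38Hyp.preservesPreSteps_treeCatVocab`, seat abc-iut-f-001, resp. `Cor38Hyp.preservesPreSteps_holds`, this seat's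
`Sec3Cor38iHolds.lean`, both via `FrdI.thm34ii_ofFunctor` of seats abc-iut-L1-t13/L1-t11), with NO FSM-type hypothesis:

* `Cor38Hyp.thm42i_of_preservesPreSteps` — the typed [FrdI] Thm. 4.2 (i) for `Ψ` (and `Ψ⁻¹`) from C38-L02a;
  `preservesPrimarySteps_of_preservesPreSteps` — row C38-L02b from C38-L01 + C38-L02a;
  `isPrimaryPreStep_map_of_preservesPreSteps` — `Ψ` carries primary pre-steps to primary pre-steps (a primary
  pre-step is a step, `PreFrobenioid.IsPrimaryPreStep.isStep`);
* **`Cor38Hyp.cor38_iii_of_preservesPreSteps`: L2-t3's typed `Cor38_iii h` HOLDS modulo `hF₁`, `hF₂` ([FrdI] Thm. 5.2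
  (ii)), C38-L01 (`h.StandardIsotropicNotGroupLike`, Thm. 3.7 (i)(ii) — PROVED at the canonical vocabularies by seat
  abc-iut-w5-d135, `standardIsotropicNotGroupLike_treeCatVocab`), C38-L02a and abc-iut-L2-d2's Def. 3.1 support
  axioms `hD1`/`hDa`/`hDn`/`hDc` on both sides**; `cor38_iii_treeCatVocab_of_preservesPreSteps` — at `treeCatVocab`,
  modulo `hBmon_i : IsMonoidOn B_i`, C38-L02a and the support axioms only.

No definitions; no statement of either paper is restated or strengthened.  HONEST FRAMING: refereed pre-IUT material;
nothing here bears on [IUTchIII] Cor. 3.12; typed ≠ proved — here PROVED modulo the named inputs.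
-/

namespace Literature.AnabelianGeometry.EtaleTheta

open CategoryTheory Opposite Literature.AlgebraicGeometry.Frobenioids

universe u₀ v₀ u v w

section TreeVocab

variable {D₀ : Type u₀} [Category.{v₀} D₀] {T : RealifiedDivisorMonoids (D₀ := D₀) treeMonoidVocab.{w}}
  {D : Type u} [Category.{v} D] {VD : FrdICatStub.{u, v, w} D}
  {D₀' : Type u₀} [Category.{v₀} D₀'] {T' : RealifiedDivisorMonoids (D₀ := D₀') treeMonoidVocab.{w}}
  {D' : Type u} [Category.{v} D'] {VD' : FrdICatStub.{u, v, w} D'}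
  {C₁ : TemperedFrobenioid T D VD} {C₂ : TemperedFrobenioid T' D' VD'} (h : Cor38Hyp C₁ C₂)

namespace Cor38Hyp

open TemperedFrobenioid

/-- **[FrdI] Thm. 4.2 (i) for `Ψ`, AS TYPED (`PreFrobenioidData.Thm42i`), from C38-L02a** (modulo `hF₁`, `hF₂`):
abc-iut-w4-d105's `FrdI.T42.thm42i_ofFunctor_of_preservesPreSteps` (perf-factorial divisor monoids: the field `isPerfFactorial`
of Def. 3.6 (ii) read at `treeMonoidVocab`). [cite: MochizukiEtTh2009, Cor 3.8 p.81] -/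
theorem thm42i_of_preservesPreSteps (hF₁ : PreFrobenioid.IsFrobenioid C₁.toElem)
    (hF₂ : PreFrobenioid.IsFrobenioid C₂.toElem) (hps : h.PreservesPreSteps) : C₁.opsData.Thm42i C₂.opsData h.Ψ :=
  FrdI.T42.thm42i_ofFunctor_of_preservesPreSteps h.Ψ hF₁ hF₂ (fun X => C₁.isPerfFactorial (op X))
    (fun X => C₂.isPerfFactorial (op X))
    (fun _ _ φ hφ => (PreFrobenioidData.ofFunctor_isPreStep C₂.toElem _).1
      (hps.1 φ ((PreFrobenioidData.ofFunctor_isPreStep C₁.toElem φ).2 hφ)))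
    (fun _ _ φ hφ => (PreFrobenioidData.ofFunctor_isPreStep C₁.toElem _).1
      (hps.2 φ ((PreFrobenioidData.ofFunctor_isPreStep C₂.toElem φ).2 hφ)))

/-- … and for `Ψ⁻¹`. [cite: MochizukiEtTh2009, Cor 3.8 p.81] -/
theorem thm42i_symm_of_preservesPreSteps (hF₁ : PreFrobenioid.IsFrobenioid C₁.toElem)
    (hF₂ : PreFrobenioid.IsFrobenioid C₂.toElem) (hps : h.PreservesPreSteps) :
    C₂.opsData.Thm42i C₁.opsData h.Ψ.symm :=
  FrdI.T42.thm42i_ofFunctor_of_preservesPreSteps h.Ψ.symm hF₂ hF₁ (fun X => C₂.isPerfFactorial (op X))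
    (fun X => C₁.isPerfFactorial (op X))
    (fun _ _ φ hφ => (PreFrobenioidData.ofFunctor_isPreStep C₁.toElem _).1
      (hps.2 φ ((PreFrobenioidData.ofFunctor_isPreStep C₂.toElem φ).2 hφ)))
    (fun _ _ φ hφ => (PreFrobenioidData.ofFunctor_isPreStep C₂.toElem _).1
      (hps.1 φ ((PreFrobenioidData.ofFunctor_isPreStep C₁.toElem φ).2 hφ)))

/-- **Row C38-L02b ⟸ C38-L01 + C38-L02a** (modulo `hF_i`): `Ψ`, `Ψ⁻¹` carry primary steps to primary steps (the frozen
derivation `preservesPrimarySteps_of_thm42i` fired with Thm. 4.2 (i) from pre-step preservation). PROVED.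
[cite: MochizukiEtTh2009, Cor 3.8 p.81] -/
theorem preservesPrimarySteps_of_preservesPreSteps (hF₁ : PreFrobenioid.IsFrobenioid C₁.toElem)
    (hF₂ : PreFrobenioid.IsFrobenioid C₂.toElem) (H : h.StandardIsotropicNotGroupLike) (hps : h.PreservesPreSteps) :
    h.PreservesPrimarySteps :=
  h.preservesPrimarySteps_of_thm42i (h.thm42i_of_preservesPreSteps hF₁ hF₂ hps)
    (h.thm42i_symm_of_preservesPreSteps hF₁ hF₂ hps) H

/-- **`Ψ` carries primary pre-steps to primary pre-steps** (the input `hprim` of abc-iut-L2-d2's `cor38_iii_of`), from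
C38-L01 + C38-L02a: a primary pre-step is a step (`IsPrimaryPreStep.isStep`), and Thm. 4.2 (i) preserves primary steps.
PROVED. [cite: MochizukiEtTh2009, Cor 3.8 p.82] -/
theorem isPrimaryPreStep_map_of_preservesPreSteps (hF₁ : PreFrobenioid.IsFrobenioid C₁.toElem)
    (hF₂ : PreFrobenioid.IsFrobenioid C₂.toElem) (H : h.StandardIsotropicNotGroupLike) (hps : h.PreservesPreSteps)
    ⦃X Y : C₁.category⦄ (φ : X ⟶ Y) (hφ : PreFrobenioid.IsPrimaryPreStep C₁.toElem φ) :
    PreFrobenioid.IsPrimaryPreStep C₂.toElem (h.Ψ.functor.map φ) :=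
  ((h.preservesPrimarySteps_of_preservesPreSteps hF₁ hF₂ H hps).1 φ ⟨hφ.isStep hF₁.isPreFrobenioid, hφ⟩).2

/-- … and `Ψ⁻¹` (the input `hprim'`). PROVED. [cite: MochizukiEtTh2009, Cor 3.8 p.82] -/
theorem isPrimaryPreStep_inverse_map_of_preservesPreSteps (hF₁ : PreFrobenioid.IsFrobenioid C₁.toElem)
    (hF₂ : PreFrobenioid.IsFrobenioid C₂.toElem) (H : h.StandardIsotropicNotGroupLike) (hps : h.PreservesPreSteps)
    ⦃X Y : C₂.category⦄ (φ : X ⟶ Y) (hφ : PreFrobenioid.IsPrimaryPreStep C₂.toElem φ) :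
    PreFrobenioid.IsPrimaryPreStep C₁.toElem (h.Ψ.inverse.map φ) :=
  ((h.preservesPrimarySteps_of_preservesPreSteps hF₁ hF₂ H hps).2 φ ⟨hφ.isStep hF₂.isPreFrobenioid, hφ⟩).2

/-- **[EtTh] Cor. 3.8 (iii), first clause, AS TYPED (abc-iut-L2-t3's `Cor38_iii`) HOLDS modulo `hF₁`, `hF₂` ([FrdI]
Thm. 5.2 (ii)), C38-L01 (Thm. 3.7 (i)(ii)), C38-L02a ([FrdI] Thm. 3.4 (ii) — a tree theorem over print's FSMFF-type
bases) and abc-iut-L2-d2's Def. 3.1 support axioms on both sides** — primary pre-steps via Thm. 4.2 (i), Frobenius type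
via Thm. 3.4 (iii), both theorems from pre-step preservation; no FSM-type hypothesis. PROVED.
[cite: MochizukiEtTh2009, Cor 3.8 p.81] -/
theorem cor38_iii_of_preservesPreSteps (hF₁ : PreFrobenioid.IsFrobenioid C₁.toElem)
    (hF₂ : PreFrobenioid.IsFrobenioid C₂.toElem) (H : h.StandardIsotropicNotGroupLike) (hps : h.PreservesPreSteps)
    (hD1₁ : ∀ (A : Dᵒᵖ) (y : C₁.Φ.carrier A), C₁.IsBaseFieldTheoreticDiv y → C₁.IsNonCuspidal y)
    (hDa₁ : ∀ (A : Dᵒᵖ) (x : C₁.Φ.carrier A), C₁.IsNonCuspidal x → C₁.IsCuspidal x → x = 1)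
    (hDn₁ : ∀ (A : Dᵒᵖ) (x : C₁.Φ.carrier A),
      C₁.IsNonCuspidal x ↔ ∀ y : C₁.Φ.carrier A, IsPrimary y → Precsim y x → C₁.IsNonCuspidal y)
    (hDc₁ : ∀ (A : Dᵒᵖ) (x : C₁.Φ.carrier A),
      C₁.IsCuspidal x ↔ ∀ y : C₁.Φ.carrier A, IsPrimary y → Precsim y x → C₁.IsCuspidal y)
    (hD1₂ : ∀ (A : D'ᵒᵖ) (y : C₂.Φ.carrier A), C₂.IsBaseFieldTheoreticDiv y → C₂.IsNonCuspidal y)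
    (hDa₂ : ∀ (A : D'ᵒᵖ) (x : C₂.Φ.carrier A), C₂.IsNonCuspidal x → C₂.IsCuspidal x → x = 1)
    (hDn₂ : ∀ (A : D'ᵒᵖ) (x : C₂.Φ.carrier A),
      C₂.IsNonCuspidal x ↔ ∀ y : C₂.Φ.carrier A, IsPrimary y → Precsim y x → C₂.IsNonCuspidal y)
    (hDc₂ : ∀ (A : D'ᵒᵖ) (x : C₂.Φ.carrier A),
      C₂.IsCuspidal x ↔ ∀ y : C₂.Φ.carrier A, IsPrimary y → Precsim y x → C₂.IsCuspidal y) :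
    Literature.AnabelianGeometry.EtaleTheta.Cor38_iii h :=
  cor38_iii_of h
    (fun _ _ φ hφ => (PreFrobenioidData.ofFunctor_isPreStep C₂.toElem _).1
      (hps.1 φ ((PreFrobenioidData.ofFunctor_isPreStep C₁.toElem φ).2 hφ)))
    (fun _ _ φ hφ => (PreFrobenioidData.ofFunctor_isPreStep C₁.toElem _).1
      (hps.2 φ ((PreFrobenioidData.ofFunctor_isPreStep C₂.toElem φ).2 hφ)))
    (h.isPrimaryPreStep_map_of_preservesPreSteps hF₁ hF₂ H hps)
    (h.isPrimaryPreStep_inverse_map_of_preservesPreSteps hF₁ hF₂ H hps)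
    (fun _ _ φ hφ => (h.isFrobeniusCompatible_of_preservesPreSteps hF₁ hF₂ hps).isFrobeniusType_map φ hφ)
    (fun _ _ φ hφ => (h.isFrobeniusCompatible_inverse_of_preservesPreSteps hF₁ hF₂ hps).isFrobeniusType_map φ hφ)
    hD1₁ hDa₁ hDn₁ hDc₁ hD1₂ hDa₂ hDn₂ hDc₂

end Cor38Hyp

end TreeVocab

/-! ### At the canonical category vocabulary `treeCatVocab` -/

section TreeCatVocab

variable {D₀ : Type u₀} [Category.{v₀} D₀] {T : RealifiedDivisorMonoids (D₀ := D₀) treeMonoidVocab.{w}}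
  {D : Type u} [Category.{v} D] {IsRational IsStrictlyRational : (Dᵒᵖ ⥤ CommMonCat.{w}) → Prop}
  {D₀' : Type u₀} [Category.{v₀} D₀'] {T' : RealifiedDivisorMonoids (D₀ := D₀') treeMonoidVocab.{w}}
  {D' : Type u} [Category.{v} D'] {IsRational' IsStrictlyRational' : (D'ᵒᵖ ⥤ CommMonCat.{w}) → Prop}
  {C₁ : TemperedFrobenioid T D (treeCatVocab D IsRational IsStrictlyRational)}
  {C₂ : TemperedFrobenioid T' D' (treeCatVocab D' IsRational' IsStrictlyRational')} (h : Cor38Hyp C₁ C₂)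

/-- **[EtTh] Cor. 3.8 (iii), first clause, AS TYPED at the canonical [FrdI] vocabularies, modulo `hBmon_i : IsMonoidOn
B_i` ("`𝔹` a monoid on `D`"; `C_i → F_{Φ_i}` then IS a Frobenioid, [FrdI] Thm. 5.2 (ii), and C38-L01 holds — seat
abc-iut-w5-d135, `standardIsotropicNotGroupLike_treeCatVocab`), C38-L02a and abc-iut-L2-d2's Def. 3.1 support axioms
only.** PROVED. [cite: MochizukiEtTh2009, Cor 3.8 p.81] -/
theorem Cor38Hyp.cor38_iii_treeCatVocab_of_preservesPreSteps (hBmon₁ : IsMonoidOn C₁.ratFnFunctor)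
    (hBmon₂ : IsMonoidOn C₂.ratFnFunctor) (hps : h.PreservesPreSteps)
    (hD1₁ : ∀ (A : Dᵒᵖ) (y : C₁.Φ.carrier A), C₁.IsBaseFieldTheoreticDiv y → C₁.IsNonCuspidal y)
    (hDa₁ : ∀ (A : Dᵒᵖ) (x : C₁.Φ.carrier A), C₁.IsNonCuspidal x → C₁.IsCuspidal x → x = 1)
    (hDn₁ : ∀ (A : Dᵒᵖ) (x : C₁.Φ.carrier A),
      C₁.IsNonCuspidal x ↔ ∀ y : C₁.Φ.carrier A, IsPrimary y → Precsim y x → C₁.IsNonCuspidal y)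
    (hDc₁ : ∀ (A : Dᵒᵖ) (x : C₁.Φ.carrier A),
      C₁.IsCuspidal x ↔ ∀ y : C₁.Φ.carrier A, IsPrimary y → Precsim y x → C₁.IsCuspidal y)
    (hD1₂ : ∀ (A : D'ᵒᵖ) (y : C₂.Φ.carrier A), C₂.IsBaseFieldTheoreticDiv y → C₂.IsNonCuspidal y)
    (hDa₂ : ∀ (A : D'ᵒᵖ) (x : C₂.Φ.carrier A), C₂.IsNonCuspidal x → C₂.IsCuspidal x → x = 1)
    (hDn₂ : ∀ (A : D'ᵒᵖ) (x : C₂.Φ.carrier A),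
      C₂.IsNonCuspidal x ↔ ∀ y : C₂.Φ.carrier A, IsPrimary y → Precsim y x → C₂.IsNonCuspidal y)
    (hDc₂ : ∀ (A : D'ᵒᵖ) (x : C₂.Φ.carrier A),
      C₂.IsCuspidal x ↔ ∀ y : C₂.Φ.carrier A, IsPrimary y → Precsim y x → C₂.IsCuspidal y) :
    Literature.AnabelianGeometry.EtaleTheta.Cor38_iii h :=
  h.cor38_iii_of_preservesPreSteps (C₁.isFrobenioid_treeCatVocab_of_isMonoidOn hBmon₁)
    (C₂.isFrobenioid_treeCatVocab_of_isMonoidOn hBmon₂) (h.standardIsotropicNotGroupLike_treeCatVocab hBmon₁ hBmon₂) hps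
    hD1₁ hDa₁ hDn₁ hDc₁ hD1₂ hDa₂ hDn₂ hDc₂

end TreeCatVocab

end Literature.AnabelianGeometry.EtaleTheta
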